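import Summits.BirchSwinnertonDyer.BirchSwinnertonDyer.Theorems.PrintCFramBottomClassIndexLawFiveLeHeegnerFieldSupplySeedTwist
import Summits.BirchSwinnertonDyer.BirchSwinnertonDyer.Theorems.PrintCFramBottomClassIndexLawFiveLeHeegnerFieldSupplyCuspSplit
import HarnessLib

/-!
# Crux `PrintCFram.BottomClassIndexLawFiveLe` (stmt-BirchSwinnertonDyer-20372), line `eisenstein-resource-bdp-line` (registry v22):
# THE RESIDUAL SEED `stub_seedOffExc` ⟸ (TwistReg⁶) restricted to the cusp-exceptional classes
# (cell `bsd-print-cfram`, width seat `bsd-line-cfram-p1-w3` g11; THEOREMS ONLY, `--supports` 20372; BSD is not proved by any of this)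

HONEST FRAMING. Nothing here is a statement about BSD; no stub is closed; `stub_seedOffExc` is REDUCED, not proved. LEAD g12's registry v22
(`Lines/eisenstein_resource_bdp_line.lean`, 2026-08-29) split v21's analytic residue `stub_seedOff` into the PRINT-DERIVABLE Eisenstein cusp
seed `stub_cuspSeed` (classes whose `m` has NO prime factor `ℓ ≡ ±1 (mod p)`: the cusp-`0` constant of the `m`-cut Cohen–Eisenstein series is a
`p`-unit, LEAD g12 crux notes §11, cross-checked by w5 g5) and the thin research residue `stub_seedOffExc` (regular classes OFF the locus `L(m,p)`
WITH such a prime), composed by `HeegnerFieldSupply.stubC_of_atP_of_cuspSeed_of_exc` (p684982). This seat's `…HeegnerFieldSupplySeedTwist`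
(p684204) proved `stub_seedOff ⟸ (TwistReg⁶)` (a regular `p`-ramified real-twist partner gives the seed `ℚ(√−ps)`) and `…SeedTwistConverse`
(p685617) the converse on the `p`-ramified side. This file restricts the reduction to v22's residue, VERBATIM:

* `seedOffExc_six_of_twistRegularExc` — `stub_seedOffExc` ⟸ **(TwistRegExc⁶)** := (TwistReg⁶) asked only of the cusp-exceptional off-locus
  regular classes (`∃ ℓ ∣ m` prime, `ℓ ≡ ±1 (mod p)`): SOME `s ≡ 1 (mod 4)` squarefree, `s ⊥ p`, every `q ∣ m` split in `ℚ(√−ps)`, with a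
  character `χ' = χ·J(· | s)` mod `m·s` of UNIT twisted class factor `¬ ‖(p−k)⁻¹ B_{p−k,χ'}‖ ≤ p⁻¹`;
* `seedOffExc_six_of_twistRegular` — a fortiori from the unrestricted (TwistReg⁶);
* `stubC_of_atP_of_cuspSeed_of_twistRegularExc` — Stub C VERBATIM ⟸ (AtP⁶) ∧ (CuspSeed⁶) ∧ (TwistRegExc⁶).

So after v22 the last analytic research residue of the line reads, in CLASS-FACTOR currency: «every Eisenstein-regular class `e` off the locus
whose conductor has a prime `ℓ ≡ ±1 (mod p)` has an Eisenstein-REGULAR `p`-ramified real-twist partner `e·s` in its `ℚ(√−ps)`-split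
progression» (w5 g5's census: 5 of the 65 window classes are cusp-exceptional off the locus). By `…SeedTwistConverse` this is exactly the
`p`-ramified half of `stub_seedOffExc`. beyond-print theorem: NO.

References: [Washington1997] Thm. 5.11, Cor. 5.13; [Cox2013] §1.C Lemma 1.14; [Cohen1975] Thm. 3.1; [KrizLi2019] Thm. 1.20, §8.
-/

set_option autoImplicit false
-- summit-side namespace `Summit.BirchSwinnertonDyer.BirchSwinnertonDyer.…` (single-conjunct summit, D-0017 layout)
set_option linter.dupNamespace false

noncomputable section

open scoped Classical NumberTheorySymbols
open NumberField WeierstrassCurve DirichletCharacter Literature.NumberTheory.LFunctions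
  Literature.NumberTheory.EllipticCurves Literature.NumberTheory.EllipticCurves.KrizLi2019
  Literature.NumberTheory.EllipticCurves.Rank1Residual Literature.NumberTheory.Congruences
  Literature.NumberTheory.QuadraticFields

namespace Summit.BirchSwinnertonDyer.BirchSwinnertonDyer.Theorems.PrintCFram.HeegnerFieldSupply

open Summit.BirchSwinnertonDyer.BirchSwinnertonDyer.Theorems.PrintCFram

/-! ## §1 `stub_seedOffExc` VERBATIM ⟸ (TwistRegExc⁶) -/

/-- **`stub_seedOffExc` ⟸ (TwistRegExc⁶).** LEAD g12's hypothesis `hExc` of `stubC_of_atP_of_cuspSeed_of_exc` (p684982) = registry v22's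
`stub_seedOffExc` VERBATIM — a seed for the REGULAR classes OFF the locus `L(m,p)` whose `m` has a prime factor `ℓ ≡ ±1 (mod p)` — follows from
(TwistReg⁶) asked of those classes only: a `p`-ramified real-twist partner `(s, χ' = χ·J(· | s))` in the `ℚ(√−ps)`-split progression with UNIT
twisted class factor. Pointwise `seed_of_ramifiedTwist` (p684204). [cite: Washington1997, Thm. 5.11 and Cor. 5.13] [cite: Cox2013, §1.C Lemma 1.14] -/
theorem seedOffExc_six_of_twistRegularExc
    (hTwExc : ∀ (p : ℕ) [Fact p.Prime] (m : ℕ) [NeZero m] (χ : DirichletCharacter ℚ_[p] m) (k : ℕ),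
      (p = 7 ∨ p = 11 ∨ p = 19 ∨ p = 43 ∨ p = 67 ∨ p = 163) →
      m.Coprime p → χ.IsPrimitive → χ.IsQuadratic → (k = (p + 1) / 4 ∨ k = (3 * p - 1) / 4) →
      2 ≤ k → k ≤ p - 2 → χ (-1) * (-1) ^ k = -1 →
      ¬ ((∀ q : ℕ, q.Prime → q ∣ m → q ≠ 2 → jacobiSym (-(p : ℤ)) q = 1) ∧ (2 ∣ m → p % 8 = 7)) →
      (∃ ℓ : ℕ, ℓ.Prime ∧ ℓ ∣ m ∧ (ℓ % p = 1 ∨ ℓ % p = p - 1)) →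
      ¬ ‖((p - k : ℕ) : ℚ_[p])⁻¹ * generalizedBernoulli (p - k) χ‖ ≤ (p : ℝ)⁻¹ →
      ∃ (s : ℕ) (_ : NeZero s) (χ' : DirichletCharacter ℚ_[p] (m * s)),
        s % 4 = 1 ∧ Squarefree s ∧ s.Coprime p ∧
        ((∀ q : ℕ, q.Prime → q ∣ m → q ≠ 2 → jacobiSym (-((p * s : ℕ) : ℤ)) q = 1) ∧ (2 ∣ m → (p * s) % 8 = 7)) ∧
        (∀ a : ℕ, χ' (a : ZMod (m * s)) = χ (a : ZMod m) * (J((a : ℤ) | s) : ℚ_[p])) ∧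
        ¬ ‖((p - k : ℕ) : ℚ_[p])⁻¹ * generalizedBernoulli (p - k) χ'‖ ≤ (p : ℝ)⁻¹) :
    ∀ (p : ℕ) [Fact p.Prime] (m : ℕ) [NeZero m] (χ : DirichletCharacter ℚ_[p] m) (k : ℕ),
      (p = 7 ∨ p = 11 ∨ p = 19 ∨ p = 43 ∨ p = 67 ∨ p = 163) →
      m.Coprime p → χ.IsPrimitive → χ.IsQuadratic → (k = (p + 1) / 4 ∨ k = (3 * p - 1) / 4) →
      2 ≤ k → k ≤ p - 2 → χ (-1) * (-1) ^ k = -1 →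
      ¬ ((∀ q : ℕ, q.Prime → q ∣ m → q ≠ 2 → jacobiSym (-(p : ℤ)) q = 1) ∧ (2 ∣ m → p % 8 = 7)) →
      (∃ ℓ : ℕ, ℓ.Prime ∧ ℓ ∣ m ∧ (ℓ % p = 1 ∨ ℓ % p = p - 1)) →
      ¬ ‖((p - k : ℕ) : ℚ_[p])⁻¹ * generalizedBernoulli (p - k) χ‖ ≤ (p : ℝ)⁻¹ →
      ∃ (K₀ : Type) (_ : Field K₀) (_ : NumberField K₀) (ε₀ : DirichletCharacter ℚ_[p] (NumberField.discr K₀).natAbs),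
        IsImaginaryQuadratic K₀ ∧
        (∀ q : ℕ, q.Prime → q ∣ m → ((Ideal.span {(q : ℤ)}).primesOver (𝓞 K₀)).ncard = 2) ∧
        Odd (NumberField.discr K₀) ∧ NumberField.discr K₀ < -4 ∧ IsKroneckerCharacterOf K₀ ε₀ ∧
        ¬ ‖(k : ℚ_[p])⁻¹ * @generalizedBernoulli ℚ_[p] _ _
            (changeLevel (dvd_mul_right m (NumberField.discr K₀).natAbs) χ *
              changeLevel (dvd_mul_left (NumberField.discr K₀).natAbs m) ε₀).conductor ⟨conductor_ne_zero _⟩ k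
            (changeLevel (dvd_mul_right m (NumberField.discr K₀).natAbs) χ *
              changeLevel (dvd_mul_left (NumberField.discr K₀).natAbs m) ε₀).primitiveCharacter‖ ≤ (p : ℝ)⁻¹ := by
  intro p hpF m _ χ k hp6 hmp hχ hχq hk hk2 hkp hpar hL hE hcls
  obtain ⟨s, hsne, χ', hs4, hsq, hsp, hsplit, hχ', hunit⟩ := hTwExc p m χ k hp6 hmp hχ hχq hk hk2 hkp hpar hL hE hcls
  haveI := hsne
  have hp3 : p % 4 = 3 := by rcases hp6 with h | h | h | h | h | h <;> subst h <;> norm_num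
  have h7 : 7 ≤ p := by rcases hp6 with h | h | h | h | h | h <;> omega
  exact seed_of_ramifiedTwist hp3 h7 hmp χ hχ hk hs4 hsq hsp hsplit χ' hχ' hunit

/-- **`stub_seedOffExc` ⟸ (TwistReg⁶)** (the unrestricted statement of `seedOff_six_of_twistRegular`, a fortiori: the cusp-exceptional
hypothesis is simply not used). [cite: Washington1997, Thm. 5.11 and Cor. 5.13] -/
theorem seedOffExc_six_of_twistRegular
    (hTw : ∀ (p : ℕ) [Fact p.Prime] (m : ℕ) [NeZero m] (χ : DirichletCharacter ℚ_[p] m) (k : ℕ),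
      (p = 7 ∨ p = 11 ∨ p = 19 ∨ p = 43 ∨ p = 67 ∨ p = 163) →
      m.Coprime p → χ.IsPrimitive → χ.IsQuadratic → (k = (p + 1) / 4 ∨ k = (3 * p - 1) / 4) →
      2 ≤ k → k ≤ p - 2 → χ (-1) * (-1) ^ k = -1 →
      ¬ ((∀ q : ℕ, q.Prime → q ∣ m → q ≠ 2 → jacobiSym (-(p : ℤ)) q = 1) ∧ (2 ∣ m → p % 8 = 7)) →
      ¬ ‖((p - k : ℕ) : ℚ_[p])⁻¹ * generalizedBernoulli (p - k) χ‖ ≤ (p : ℝ)⁻¹ →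
      ∃ (s : ℕ) (_ : NeZero s) (χ' : DirichletCharacter ℚ_[p] (m * s)),
        s % 4 = 1 ∧ Squarefree s ∧ s.Coprime p ∧
        ((∀ q : ℕ, q.Prime → q ∣ m → q ≠ 2 → jacobiSym (-((p * s : ℕ) : ℤ)) q = 1) ∧ (2 ∣ m → (p * s) % 8 = 7)) ∧
        (∀ a : ℕ, χ' (a : ZMod (m * s)) = χ (a : ZMod m) * (J((a : ℤ) | s) : ℚ_[p])) ∧
        ¬ ‖((p - k : ℕ) : ℚ_[p])⁻¹ * generalizedBernoulli (p - k) χ'‖ ≤ (p : ℝ)⁻¹) :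
    ∀ (p : ℕ) [Fact p.Prime] (m : ℕ) [NeZero m] (χ : DirichletCharacter ℚ_[p] m) (k : ℕ),
      (p = 7 ∨ p = 11 ∨ p = 19 ∨ p = 43 ∨ p = 67 ∨ p = 163) →
      m.Coprime p → χ.IsPrimitive → χ.IsQuadratic → (k = (p + 1) / 4 ∨ k = (3 * p - 1) / 4) →
      2 ≤ k → k ≤ p - 2 → χ (-1) * (-1) ^ k = -1 →
      ¬ ((∀ q : ℕ, q.Prime → q ∣ m → q ≠ 2 → jacobiSym (-(p : ℤ)) q = 1) ∧ (2 ∣ m → p % 8 = 7)) →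
      (∃ ℓ : ℕ, ℓ.Prime ∧ ℓ ∣ m ∧ (ℓ % p = 1 ∨ ℓ % p = p - 1)) →
      ¬ ‖((p - k : ℕ) : ℚ_[p])⁻¹ * generalizedBernoulli (p - k) χ‖ ≤ (p : ℝ)⁻¹ →
      ∃ (K₀ : Type) (_ : Field K₀) (_ : NumberField K₀) (ε₀ : DirichletCharacter ℚ_[p] (NumberField.discr K₀).natAbs),
        IsImaginaryQuadratic K₀ ∧
        (∀ q : ℕ, q.Prime → q ∣ m → ((Ideal.span {(q : ℤ)}).primesOver (𝓞 K₀)).ncard = 2) ∧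
        Odd (NumberField.discr K₀) ∧ NumberField.discr K₀ < -4 ∧ IsKroneckerCharacterOf K₀ ε₀ ∧
        ¬ ‖(k : ℚ_[p])⁻¹ * @generalizedBernoulli ℚ_[p] _ _
            (changeLevel (dvd_mul_right m (NumberField.discr K₀).natAbs) χ *
              changeLevel (dvd_mul_left (NumberField.discr K₀).natAbs m) ε₀).conductor ⟨conductor_ne_zero _⟩ k
            (changeLevel (dvd_mul_right m (NumberField.discr K₀).natAbs) χ *
              changeLevel (dvd_mul_left (NumberField.discr K₀).natAbs m) ε₀).primitiveCharacter‖ ≤ (p : ℝ)⁻¹ := by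
  intro p hpF m _ χ k hp6 hmp hχ hχq hk hk2 hkp hpar hL _hE hcls
  exact seedOff_six_of_twistRegular hTw p m χ k hp6 hmp hχ hχq hk hk2 hkp hpar hL hcls

/-! ## §2 Stub C VERBATIM ⟸ (AtP⁶) ∧ (CuspSeed⁶) ∧ (TwistRegExc⁶) -/

/-- **Stub C VERBATIM ⟸ (AtP⁶) ∧ (CuspSeed⁶) ∧ (TwistRegExc⁶)**: LEAD g12's v22 composition `stubC_of_atP_of_cuspSeed_of_exc` (p684982) with
`hExc` discharged by `seedOffExc_six_of_twistRegularExc`. Granting the two print-derivable statements (the θ-cycle propagation at `p` and the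
Eisenstein cusp seed), registry v19's Stub C reduces to ONE horizontal statement in class-factor currency on the cusp-exceptional off-locus
classes. BSD is not proved by any of this; Stub C is NOT claimed proved. [cite: KrizLi2019, Thm. 1.20 (p. 8) and §8 (pp. 49–52)] [cite: Cohen1975, Thm. 3.1]
[cite: AhlgrenBoylan2003, Thm. 3] -/
theorem stubC_of_atP_of_cuspSeed_of_twistRegularExc
    (hAt : ∀ (p : ℕ) [Fact p.Prime] (m : ℕ) [NeZero m] (χ : DirichletCharacter ℚ_[p] m) (k : ℕ),
      (p = 7 ∨ p = 11 ∨ p = 19 ∨ p = 43 ∨ p = 67 ∨ p = 163) →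
      m.Coprime p → χ.IsPrimitive → χ.IsQuadratic → (k = (p + 1) / 4 ∨ k = (3 * p - 1) / 4) →
      2 ≤ k → k ≤ p - 2 → χ (-1) * (-1) ^ k = -1 →
      (∃ (K₀ : Type) (_ : Field K₀) (_ : NumberField K₀) (ε₀ : DirichletCharacter ℚ_[p] (NumberField.discr K₀).natAbs),
        IsImaginaryQuadratic K₀ ∧
        (∀ q : ℕ, q.Prime → q ∣ m → ((Ideal.span {(q : ℤ)}).primesOver (𝓞 K₀)).ncard = 2) ∧
        Odd (NumberField.discr K₀) ∧ NumberField.discr K₀ < -4 ∧ IsKroneckerCharacterOf K₀ ε₀ ∧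
        ¬ ‖(k : ℚ_[p])⁻¹ * @generalizedBernoulli ℚ_[p] _ _
            (changeLevel (dvd_mul_right m (NumberField.discr K₀).natAbs) χ *
              changeLevel (dvd_mul_left (NumberField.discr K₀).natAbs m) ε₀).conductor ⟨conductor_ne_zero _⟩ k
            (changeLevel (dvd_mul_right m (NumberField.discr K₀).natAbs) χ *
              changeLevel (dvd_mul_left (NumberField.discr K₀).natAbs m) ε₀).primitiveCharacter‖ ≤ (p : ℝ)⁻¹) →
      ∃ (K : Type) (_ : Field K) (_ : NumberField K) (εK : DirichletCharacter ℚ_[p] (NumberField.discr K).natAbs),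
        IsImaginaryQuadratic K ∧
        (∀ q : ℕ, q.Prime → q ∣ p * m → ((Ideal.span {(q : ℤ)}).primesOver (𝓞 K)).ncard = 2) ∧
        Odd (NumberField.discr K) ∧ NumberField.discr K < -4 ∧ IsKroneckerCharacterOf K εK ∧
        ¬ ‖(k : ℚ_[p])⁻¹ * @generalizedBernoulli ℚ_[p] _ _
            (changeLevel (dvd_mul_right m (NumberField.discr K).natAbs) χ *
              changeLevel (dvd_mul_left (NumberField.discr K).natAbs m) εK).conductor ⟨conductor_ne_zero _⟩ k
            (changeLevel (dvd_mul_right m (NumberField.discr K).natAbs) χ *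
              changeLevel (dvd_mul_left (NumberField.discr K).natAbs m) εK).primitiveCharacter‖ ≤ (p : ℝ)⁻¹)
    (hCusp : ∀ (p : ℕ) [Fact p.Prime] (m : ℕ) [NeZero m] (χ : DirichletCharacter ℚ_[p] m) (k : ℕ),
      (p = 7 ∨ p = 11 ∨ p = 19 ∨ p = 43 ∨ p = 67 ∨ p = 163) →
      m.Coprime p → χ.IsPrimitive → χ.IsQuadratic → (k = (p + 1) / 4 ∨ k = (3 * p - 1) / 4) →
      2 ≤ k → k ≤ p - 2 → χ (-1) * (-1) ^ k = -1 →
      ¬ (∃ ℓ : ℕ, ℓ.Prime ∧ ℓ ∣ m ∧ (ℓ % p = 1 ∨ ℓ % p = p - 1)) →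
      ∃ (K₀ : Type) (_ : Field K₀) (_ : NumberField K₀) (ε₀ : DirichletCharacter ℚ_[p] (NumberField.discr K₀).natAbs),
        IsImaginaryQuadratic K₀ ∧
        (∀ q : ℕ, q.Prime → q ∣ m → ((Ideal.span {(q : ℤ)}).primesOver (𝓞 K₀)).ncard = 2) ∧
        Odd (NumberField.discr K₀) ∧ NumberField.discr K₀ < -4 ∧ IsKroneckerCharacterOf K₀ ε₀ ∧
        ¬ ‖(k : ℚ_[p])⁻¹ * @generalizedBernoulli ℚ_[p] _ _
            (changeLevel (dvd_mul_right m (NumberField.discr K₀).natAbs) χ *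
              changeLevel (dvd_mul_left (NumberField.discr K₀).natAbs m) ε₀).conductor ⟨conductor_ne_zero _⟩ k
            (changeLevel (dvd_mul_right m (NumberField.discr K₀).natAbs) χ *
              changeLevel (dvd_mul_left (NumberField.discr K₀).natAbs m) ε₀).primitiveCharacter‖ ≤ (p : ℝ)⁻¹)
    (hTwExc : ∀ (p : ℕ) [Fact p.Prime] (m : ℕ) [NeZero m] (χ : DirichletCharacter ℚ_[p] m) (k : ℕ),
      (p = 7 ∨ p = 11 ∨ p = 19 ∨ p = 43 ∨ p = 67 ∨ p = 163) →
      m.Coprime p → χ.IsPrimitive → χ.IsQuadratic → (k = (p + 1) / 4 ∨ k = (3 * p - 1) / 4) →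
      2 ≤ k → k ≤ p - 2 → χ (-1) * (-1) ^ k = -1 →
      ¬ ((∀ q : ℕ, q.Prime → q ∣ m → q ≠ 2 → jacobiSym (-(p : ℤ)) q = 1) ∧ (2 ∣ m → p % 8 = 7)) →
      (∃ ℓ : ℕ, ℓ.Prime ∧ ℓ ∣ m ∧ (ℓ % p = 1 ∨ ℓ % p = p - 1)) →
      ¬ ‖((p - k : ℕ) : ℚ_[p])⁻¹ * generalizedBernoulli (p - k) χ‖ ≤ (p : ℝ)⁻¹ →
      ∃ (s : ℕ) (_ : NeZero s) (χ' : DirichletCharacter ℚ_[p] (m * s)),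
        s % 4 = 1 ∧ Squarefree s ∧ s.Coprime p ∧
        ((∀ q : ℕ, q.Prime → q ∣ m → q ≠ 2 → jacobiSym (-((p * s : ℕ) : ℤ)) q = 1) ∧ (2 ∣ m → (p * s) % 8 = 7)) ∧
        (∀ a : ℕ, χ' (a : ZMod (m * s)) = χ (a : ZMod m) * (J((a : ℤ) | s) : ℚ_[p])) ∧
        ¬ ‖((p - k : ℕ) : ℚ_[p])⁻¹ * generalizedBernoulli (p - k) χ'‖ ≤ (p : ℝ)⁻¹) :
    ∀ (W : WeierstrassCurve ℚ) [W.IsElliptic] [W.IsGloballyMinimal] (p : ℕ) [Fact p.Prime], W.HasCM → CMRamified W p → 5 ≤ p →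
      W.analyticRank = 1 → ∀ (f : ℕ) [NeZero f] (ψ : DirichletCharacter ℚ_[p] f) (ω : DirichletCharacter ℚ_[p] p), ψ.Odd →
      IsTeichmullerCharacter ω →
      (∀ ℓ : ℕ, ℓ.Prime → ¬ (ℓ ∣ p * W.conductorNorm ℤ) →
        ‖((W.LFunction ℓ : ℤ) : ℚ_[p]) - (ψ (ℓ : ZMod f) + ψ⁻¹ (ℓ : ZMod f) * ω (ℓ : ZMod p))‖ < 1) →
      ¬ ‖bernoulliOnePrim ψ⁻¹‖ ≤ (p : ℝ)⁻¹ →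
      ∃ (K : Type) (_ : Field K) (_ : NumberField K) (εK : DirichletCharacter ℚ_[p] (NumberField.discr K).natAbs),
        IsImaginaryQuadratic K ∧ SatisfiesHeegnerHypothesis (W.conductorNorm ℤ) K ∧ Odd (NumberField.discr K) ∧
        NumberField.discr K < -4 ∧ IsKroneckerCharacterOf K εK ∧
        ¬ ‖bernoulliOnePrim (bernoulliCharTwo ψ εK ω)‖ ≤ (p : ℝ)⁻¹ :=
  stubC_of_atP_of_cuspSeed_of_exc hAt hCusp (seedOffExc_six_of_twistRegularExc hTwExc)

end Summit.BirchSwinnertonDyer.BirchSwinnertonDyer.Theorems.PrintCFram.HeegnerFieldSupply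

end
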